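import Literature.NumberTheory.Kottwitz1992.HermitianSymmetricSpaces
import Literature.LinearAlgebra.DiagonalizableEigenspaces
import HarnessLib

/-!
# [Kottwitz1992, §4 pp. 386–387] The case `D = ℂ` of the classification of `h : ℂ → C_ℝ` — DISCHARGED:
# `Kottwitz1992_4_class_complex_holds`

Kernel-lane companion of the statement carpet ★ `Literature/NumberTheory/Kottwitz1992/HermitianSymmetricSpaces.lean` (squad TK; its ED. 1
companion ★ `HermitianSymmetricSpacesHolds` pays the case `D = ℝ`): the named fact ★ `HermitianSymmetricSpaces.Kottwitz1992_4_class_complex` —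
«If `D = ℂ`, then `ℂ ⊗_ℝ D = ℂ × ℂ`, and up to inner automorphisms of `(C, ι)`, there is a `*`-homomorphism `ℂ → C` for each pair `(p, q)` of
nonnegative integers such that `p + q = n`», typed as: every `ℝ`-algebra map `h : ℂ → M_n(ℂ)` is `GL_n(ℂ)`-conjugate to
`z ↦ diag(z, …, z, z̄, …, z̄)` (`p` entries `z`) for exactly one `p ≤ n` — is PROVED here.  THEOREMS ONLY (no definition, no named fact, no `sorry`,
no instance, no notation); cell hodgecm-mathlib, seat B-typ02 (g31); net debt −1.

R. E. Kottwitz, *Points on some Shimura varieties over finite fields*, J. Amer. Math. Soc. 5 (1992), §4 p. 386 L44 – p. 387 L1 (held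
`paper:doi-10-2307-2152772`, p0014 L39–L48, p0015 L1).  THE PRINTED ARGUMENT: «classifying `ℝ`-algebra homomorphisms `ℂ → C` up to conjugacy by
`C^×` […] is the same as classifying isomorphism classes of `ℂ ⊗_ℝ D`-modules that are of rank `n` as `D`-modules. […] If `D = ℂ`, then
`ℂ ⊗_ℝ D = ℂ × ℂ`», whose modules of rank `n` are `ℂ^p × ℂ^q`, `p + q = n`.  In matrices (this file): an `ℝ`-algebra map `h : ℂ → M_n(ℂ)` is
`h(z) = re z · 1 + im z · J` with `J = h(i)`, `J² = −1` (§1); `(X − i)(X + i)` kills `J`, so `J` is diagonalisable over `ℂ` (the tree's ★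
`Literature.LinearAlgebra.exists_basis_toMatrix_eq_diagonal_of_aeval_prod_X_sub_C_eq_zero`, Hoffman–Kunze §6.4 Thm. 6, with ★
`Literature.LinearAlgebra.Matrix.exists_isUnit_conj_eq_of_toMatrix_toLin'_eq`) with eigenvalues `±i` — the two factors of `ℂ × ℂ` — and after a
permutation of the eigenbasis (`p` = the number of eigenvalues `i`) `J = g · diag(i,…,i,−i,…,−i) · g⁻¹`, whence `h(z) = g · diag(z,…,z,z̄,…,z̄) · g⁻¹`
(§3); `p` is unique because `tr h(i) = (p − q) i` (§2).
HONEST LABEL: HC_CM is proved only modulo the 7 printed citations (2 remaining: hLiu418, h413) until rung 0 closes; this file adds no citation debt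
(0 facts, 0 sorry) and discharges 1 named fact of ★ `HermitianSymmetricSpaces`.

## References
* [Kottwitz1992] R. E. Kottwitz, Points on some Shimura varieties over finite fields, J. Amer. Math. Soc. 5 (1992) 373–444, §4 pp. 386–387.
* [HoffmanKunze1971LinearAlgebra] K. Hoffman, R. Kunze, *Linear Algebra*, §6.4 Theorem 6 (through ★ `Literature.LinearAlgebra.DiagonalizableEigenspaces`).
-/

noncomputable section

open Polynomial Module
open scoped ComplexConjugate

namespace Literature.NumberTheory.Kottwitz1992.HermitianSymmetricSpaces

/-! ## §1 `ℝ`-algebra maps `ℂ → A` -/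

/-- Every `ℝ`-algebra map `h : ℂ → A` is `h(z) = re z · 1 + im z · h(i)` (here with complex scalars on a `ℂ`-algebra `A` that is also an
`ℝ`-algebra compatibly). [cite: Kottwitz1992, §4 (p. 386)] -/
private theorem algHom_apply_eq {n : ℕ} (h : ℂ →ₐ[ℝ] Matrix (Fin n) (Fin n) ℂ) (z : ℂ) :
    h z = (z.re : ℂ) • (1 : Matrix (Fin n) (Fin n) ℂ) + (z.im : ℂ) • h Complex.I := by
  have hre : ∀ r : ℝ, h (r : ℂ) = (r : ℂ) • (1 : Matrix (Fin n) (Fin n) ℂ) := by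
    intro r
    rw [← Complex.coe_algebraMap, h.commutes, Algebra.algebraMap_eq_smul_one]
    ext i j
    simp [Matrix.smul_apply, Complex.real_smul]
  conv_lhs => rw [← Complex.re_add_im z]
  rw [map_add, map_mul, hre, hre, Matrix.smul_mul, Matrix.one_mul]

/-! ## §2 The trace of `diag(a, …, a, b, …, b)` -/

/-- `∑_{j < n} [j < p] a + [j ≥ p] b = p·a + (n − p)·b` for `p ≤ n`. [folklore] -/
private theorem sum_ite_val_lt {n p : ℕ} (hp : p ≤ n) (a b : ℂ) :
    (∑ j : Fin n, if (j : ℕ) < p then a else b) = (p : ℂ) * a + ((n : ℂ) - p) * b := by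
  rw [Fin.sum_univ_eq_sum_range (fun j => if j < p then a else b) n, ← Finset.sum_range_add_sum_Ico _ hp,
    Finset.sum_congr rfl fun k hk => if_pos (Finset.mem_range.mp hk),
    Finset.sum_congr rfl fun k hk => if_neg (not_lt.mpr (Finset.mem_Ico.mp hk).1),
    Finset.sum_const, Finset.sum_const, Finset.card_range, Nat.card_Ico, nsmul_eq_mul, nsmul_eq_mul, Nat.cast_sub hp]

/-- **Uniqueness of `p`**: if `diag(i,…,i,−i,…,−i)` with `p` resp. `p′` entries `i` (`p, p′ ≤ n`) have the same trace then `p = p′`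
(`tr = (2p − n) i`). [cite: Kottwitz1992, §4 (pp. 386–387)] -/
private theorem eq_of_sum_ite_eq {n p p' : ℕ} (hp : p ≤ n) (hp' : p' ≤ n)
    (h : (∑ j : Fin n, if (j : ℕ) < p then Complex.I else -Complex.I) = ∑ j : Fin n, if (j : ℕ) < p' then Complex.I else -Complex.I) :
    p = p' := by
  rw [sum_ite_val_lt hp, sum_ite_val_lt hp'] at h
  have h2 := congrArg Complex.im h
  simp only [Complex.add_im, Complex.mul_im, Complex.natCast_re, Complex.natCast_im, Complex.I_re, Complex.I_im, Complex.neg_re,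
    Complex.neg_im, Complex.sub_re, Complex.sub_im, mul_zero, zero_mul, add_zero, mul_one, sub_zero] at h2
  have h3 : (p : ℝ) = p' := by linarith
  exact_mod_cast h3

/-! ## §3 The classification -/

/-- `x² = −1` in `ℂ` forces `x = ±i`. [folklore] -/
private theorem eq_I_or_eq_neg_I {x : ℂ} (hx : x * x = -1) : x = Complex.I ∨ x = -Complex.I := by
  have h : (x - Complex.I) * (x + Complex.I) = 0 := by
    have : (x - Complex.I) * (x + Complex.I) = x * x - Complex.I * Complex.I := by ring
    rw [this, Complex.I_mul_I, hx, sub_self]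
  rcases mul_eq_zero.mp h with h1 | h1
  · exact Or.inl (sub_eq_zero.mp h1)
  · exact Or.inr (eq_neg_of_add_eq_zero_left h1)

/-- **The case `D = ℂ`, PROVED**: ★ `Kottwitz1992_4_class_complex` holds — every `ℝ`-algebra map `h : ℂ → M_n(ℂ)` is `GL_n(ℂ)`-conjugate to
`z ↦ diag(z, …, z, z̄, …, z̄)` (`p` entries `z`, `q = n − p` entries `z̄`) for exactly one `p ≤ n`. [cite: Kottwitz1992, §4 (pp. 386–387)] -/
theorem Kottwitz1992_4_class_complex_holds : Kottwitz1992_4_class_complex := by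
  intro n h
  classical
  -- `J = h(i)`, `J² = −1`
  set J : Matrix (Fin n) (Fin n) ℂ := h Complex.I with hJ
  have hJ2 : J * J = -1 := by rw [hJ, ← map_mul, Complex.I_mul_I, map_neg, map_one]
  have hIne : Complex.I ≠ -Complex.I := by
    intro h0
    have := congrArg Complex.im h0
    norm_num at this
  -- `(X − i)(X + i)` kills `γ = J` acting on `ℂⁿ`
  set γ : Module.End ℂ (Fin n → ℂ) := Matrix.toLin' J with hγ
  have hγ2 : γ * γ = -1 := by
    have hmul : Matrix.toLin' (J * J) = γ * γ := Matrix.toLin'_mul J J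
    rw [← hmul, hJ2, map_neg, Matrix.toLin'_one]
    rfl
  have hkill : aeval γ (∏ c ∈ ({Complex.I, -Complex.I} : Finset ℂ), (X - C c)) = 0 := by
    rw [Finset.prod_pair hIne]
    have hpoly : (X - C Complex.I) * (X - C (-Complex.I)) = X ^ 2 + 1 := by
      calc (X - C Complex.I) * (X - C (-Complex.I)) = X ^ 2 - C (Complex.I * Complex.I) := by rw [map_neg, map_mul]; ring
        _ = X ^ 2 + 1 := by rw [Complex.I_mul_I, map_neg, map_one, sub_neg_eq_add]
    rw [hpoly, map_add, map_pow, aeval_X, map_one, sq, hγ2, neg_add_cancel]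
  -- an eigenbasis: `γ` is diagonal with entries `±i`
  obtain ⟨b, d, hb⟩ := Literature.LinearAlgebra.exists_basis_toMatrix_eq_diagonal_of_aeval_prod_X_sub_C_eq_zero γ _ hkill
  have hd2 : Matrix.diagonal d * Matrix.diagonal d = -1 := by
    rw [← hb, ← LinearMap.toMatrix_mul, hγ2, map_neg, LinearMap.toMatrix_one]
  have hd : ∀ j, d j = Complex.I ∨ d j = -Complex.I := by
    intro j
    have h1 := congrFun (congrFun hd2 j) j
    rw [Matrix.diagonal_mul_diagonal, Matrix.diagonal_apply_eq, Matrix.neg_apply, Matrix.one_apply_eq] at h1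
    exact eq_I_or_eq_neg_I h1
  -- transport the index type to `Fin n` and SORT the eigenvalues: `i` first
  let σ : Fin n ≃ Fin (finrank ℂ (Fin n → ℂ)) := finCongr (Module.finrank_fin_fun ℂ).symm
  let P : Fin n → Prop := fun j => d (σ j) = Complex.I
  let p : ℕ := Fintype.card {j // P j}
  let q : ℕ := Fintype.card {j // ¬ P j}
  have hpq : p + q = n := by
    have h1 := Fintype.card_subtype_compl P
    have h2 := Fintype.card_subtype_le P
    simp only [Fintype.card_fin] at h1 h2
    omega
  have hpn : p ≤ n := by omega
  let e : Fin n ≃ Fin n :=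
    ((Equiv.sumCompl P).symm.trans ((Fintype.equivFin {j // P j}).sumCongr (Fintype.equivFin {j // ¬ P j}))).trans
      (finSumFinEquiv.trans (finCongr hpq))
  have he : ∀ x : Fin n, ((e x : Fin n) : ℕ) < p ↔ P x := by
    intro x
    by_cases hx : P x
    · simp only [e, Equiv.trans_apply, Equiv.sumCompl_symm_apply_of_pos hx, Equiv.sumCongr_apply, Sum.map_inl,
        finSumFinEquiv_apply_left, finCongr_apply_coe, Fin.val_castAdd]
      exact ⟨fun _ => hx, fun _ => Fin.is_lt _⟩
    · simp only [e, Equiv.trans_apply, Equiv.sumCompl_symm_apply_of_neg hx, Equiv.sumCongr_apply, Sum.map_inr,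
        finSumFinEquiv_apply_right, finCongr_apply_coe, Fin.val_natAdd]
      exact ⟨fun h0 => absurd h0 (by omega), fun h0 => absurd h0 hx⟩
  -- the sorted diagonal is `diag(i,…,i,−i,…,−i)`
  let σ' : Fin n ≃ Fin (finrank ℂ (Fin n → ℂ)) := e.symm.trans σ
  have hpat : (d ∘ σ') = fun j : Fin n => if (j : ℕ) < p then Complex.I else -Complex.I := by
    funext j
    change d (σ (e.symm j)) = _
    have hj : ((e (e.symm j) : Fin n) : ℕ) < p ↔ P (e.symm j) := he (e.symm j)
    rw [Equiv.apply_symm_apply] at hj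
    by_cases hP : P (e.symm j)
    · rw [if_pos (hj.mpr hP)]; exact hP
    · rw [if_neg (fun h0 => hP (hj.mp h0))]
      exact (hd (σ (e.symm j))).resolve_left hP
  -- `J = S · diag(i,…,i,−i,…,−i) · S⁻¹`
  obtain ⟨S, hS, hJS⟩ := Literature.LinearAlgebra.Matrix.exists_isUnit_conj_eq_of_toMatrix_toLin'_eq b hb σ'
  rw [Matrix.reindex_apply, Equiv.symm_symm, Matrix.submatrix_diagonal_equiv, hpat] at hJS
  have hSdet : IsUnit S.det := (Matrix.isUnit_iff_isUnit_det S).mp hS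
  -- existence
  refine ⟨p, ⟨hpn, hS.unit, fun z => ?_⟩, ?_⟩
  · have hdiag : (Matrix.diagonal fun j : Fin n => if (j : ℕ) < p then z else conj z) =
        (z.re : ℂ) • (1 : Matrix (Fin n) (Fin n) ℂ) +
          (z.im : ℂ) • Matrix.diagonal fun j : Fin n => if (j : ℕ) < p then Complex.I else -Complex.I := by
      ext j k
      by_cases hjk : j = k
      · subst hjk
        simp only [Matrix.diagonal_apply_eq, Matrix.add_apply, Matrix.smul_apply, Matrix.one_apply_eq, smul_eq_mul, mul_one]
        split_ifs
        · apply Complex.ext <;> simp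
        · apply Complex.ext <;> simp
      · simp [Matrix.diagonal_apply_ne _ hjk, Matrix.one_apply_ne hjk]
    rw [algHom_apply_eq h z, ← hJ, hdiag, Matrix.coe_units_inv, IsUnit.unit_spec, Matrix.mul_add, Matrix.add_mul, Matrix.mul_smul,
      Matrix.smul_mul, Matrix.mul_smul, Matrix.smul_mul, Matrix.mul_one, Matrix.mul_nonsing_inv S hSdet, ← hJS]
  -- uniqueness: the trace of `h(i)`
  · rintro p' ⟨hp'n, g', hg'⟩
    have h1 := congrArg Matrix.trace (hg' Complex.I)
    rw [Matrix.trace_units_conj, ← hJ] at h1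
    simp only [Complex.conj_I, Matrix.trace_diagonal] at h1
    have h2 : Matrix.trace J = ∑ j : Fin n, if (j : ℕ) < p then Complex.I else -Complex.I := by
      rw [hJS, Matrix.trace_mul_cycle, Matrix.nonsing_inv_mul S hSdet, Matrix.one_mul, Matrix.trace_diagonal]
    exact (eq_of_sum_ite_eq hpn hp'n (h2.symm.trans h1)).symm

end Literature.NumberTheory.Kottwitz1992.HermitianSymmetricSpaces

end
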